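import Literature.Probability.Percolation.SlabRSWCase3Crossing
import Literature.Probability.Percolation.SlabRSWGluingBound
import Literature.Probability.Percolation.SlabRSWRectCrossings
import Literature.Probability.Percolation.SlabRSWProp39
import HarnessLib

/-!
# Newman–Tassion–Wu 2017, Lemma 3.16 and `(H316)` reduced to local gadgets in `R' ∖ 𝒩(Γ, ρ₂)`

Topic: `Literature/Probability/Percolation`. Assembly of the Case-3 chain of this port:
exploration (`SlabRSWExploration.lean`), separation (`SlabRSWCase3Separation.lean`), crossing
(`SlabRSWCase3Crossing.lean`) and the abstract linear gluing bound of the tree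
(`GlueData.real_evAB_inter_evNear_le_of_gadgets`, `SlabRSWGluingBound.lean`). What is proved:

* `real_sq_le_mirrorGlue` — Harris–FKG and `τ`-symmetry:
  `P[C ⟷^{R'∖𝒩(Γ,ρ₂)} τΓ]² ≤ P[Q₁.evAB ∩ Q₁.evNear ρ]` for every `ρ` (`Q₁ = mirrorGlue n Γ ρ₂`);
* `real_evCA_mirrorGlue_le` — the glued event of `Q₁` is a left–right crossing:
  `P[Q₁.evCA] ≤ f(14n, 13n)`;
* **`h316_of_gadgets`** — the hypothesis `(H316)` of `thm314_hCase3_of` (hence `(H3)` of Theorem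
  3.14, hence NTW's Theorem 3.1 at `p_c` given (H360)) FOLLOWS from a supply of local modifications
  (`GadgetSpec`, box radius `r`) for the data `Q₁ = mirrorGlue n (Γ(ω)) ρ₂` of admissible
  configurations, with the explicit `y(x) = x² / (1 + λ^s)`, `s = 3(5k+4)(4r+1)²`.

The gadget supply is NTW's "the domain `K_□` is regular enough to apply Theorem 3.6" (Remark 2 after
Theorem 3.7); the tree's constructions (`SlabRSWGluingGeometry/Segment/Ext/ExtB`) cover rectangles,
not the domain `R' ∖ 𝒩(Γ, ρ₂)`.

## Sources

* C. M. Newman, V. Tassion, W. Wu, *Critical percolation and the minimal spanning tree in slabs*,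
  Comm. Pure Appl. Math. 70 (2017), arXiv:1512.09107: §3.5, Lemma 3.16 and the proof of Theorem 3.14,
  Case 3; Theorem 3.6 and Remark 2 after Theorem 3.7 [NewmanTassionWu2017].
-/

noncomputable section

namespace Literature.Probability.Percolation

open MeasureTheory LatticeModels SimpleGraph

namespace NTW17

variable {k : ℕ}

section L316

variable {n ρ₂ : ℕ} (hn : 1 ≤ n) {ω : BondConfig (slab 3 k)}

/-- `C̄ ⟷ 𝒩(Γ̄, 0) ⊆ C̄ ⟷ 𝒩(Γ̄, ρ)`. [cite: NewmanTassionWu2017, §3.2 (the event C ↔ 𝒩(Γ̄, r), monotone in r)] -/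
theorem GlueData.evNear_mono (Q : GlueData) {ρ ρ' : ℕ} (h : ρ ≤ ρ') : Q.evNear k ρ ⊆ Q.evNear k ρ' := by
  rintro ω ⟨c₀, hc₀, q, hq, hnear⟩
  exact ⟨c₀, hc₀, q, hq, hnear.mono h⟩

/-- Crossing events of finite planar domains are local. [cite: NewmanTassionWu2017, §3.1 (events depending on finitely many edges)] -/
theorem isLocalEvent_slabConn {B : Set (ℤ × ℤ)} (hB : B.Finite) (X Y : Set (ℤ × ℤ)) :
    IsLocalEvent (slabConn k B X Y) := by
  refine ⟨(finite_sym2 (slabLift_finite k hB)).toFinset, ?_⟩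
  rw [Set.Finite.coe_toFinset]
  exact determinedBy_slabConn k X Y subset_rfl

/-- **Harris–FKG and `τ`-symmetry** (proof of Lemma 3.16): with `Q₁ = mirrorGlue n Γ ρ₂`,
`Γ = Q.γ ω` for an admissible lattice `ω`,
`P[C ⟷^{R'∖𝒩(Γ,ρ₂)} τΓ]² ≤ P[Q₁.evAB ∩ Q₁.evNear ρ]`.
[cite: NewmanTassionWu2017, §3.5 (proof of Lemma 3.16: the symmetric pair A ↔ Y, A′ ↔ Y′ and Theorem 3.6)] -/
theorem real_sq_le_mirrorGlue (hω : ω ⊆ (slabGraph 3 k).edgeSet) (hA : ω ∈ (case2Setup n hn).Q.evAB k)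
    (p : unitInterval) (ρ : ℕ) :
    (bondPercolation (slabGraph 3 k) p).real ((mirrorGlue n hn ((case2Setup n hn).Q.γ k ω) ρ₂).evAB k) ^ 2 ≤
      (bondPercolation (slabGraph 3 k) p).real
        ((mirrorGlue n hn ((case2Setup n hn).Q.γ k ω) ρ₂).evAB k ∩
          (mirrorGlue n hn ((case2Setup n hn).Q.γ k ω) ρ₂).evNear k ρ) := by
  set E := case2Setup n hn with hE
  set Γ := E.Q.γ k ω with hΓ
  set Q₁ := mirrorGlue n hn Γ ρ₂ with hQ₁
  set τ := planarReflect (14 * (n : ℤ)) with hτ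
  set P := bondPercolation (slabGraph 3 k) p with hP
  set E₂ := slabConn k (τ '' (E.R \ {z | Near k Γ ρ₂ z})) (τ '' E.C)
    (τ '' {z | ∃ g ∈ Γ, z = τ (planar k g)}) with hE₂
  have hE₁ : Q₁.evAB k = slabConn k (E.R \ {z | Near k Γ ρ₂ z}) E.C {z | ∃ g ∈ Γ, z = τ (planar k g)} := rfl
  have hsymm : P.real E₂ = P.real (Q₁.evAB k) := by
    rw [hE₁, hE₂]
    exact real_slabConn_image k τ (planarAdj_planarReflect _) p _ _ _
  have hfin : (E.R \ {z | Near k Γ ρ₂ z}).Finite := (boxR_finite _ _ _ _).subset Set.sdiff_subset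
  have hH : P.real (Q₁.evAB k) * P.real E₂ ≤ P.real (Q₁.evAB k ∩ E₂) := by
    rw [hE₁, hE₂]
    exact harris_fkg_local (slabGraph 3 k) p (isUpperSet_openCrossing _ _ _) (isUpperSet_openCrossing _ _ _)
      (isLocalEvent_slabConn hfin _ _) (isLocalEvent_slabConn (hfin.image _) _ _)
  have hae : ∀ᵐ ω' ∂P, ω' ∈ Q₁.evAB k ∩ E₂ → ω' ∈ Q₁.evAB k ∩ Q₁.evNear k ρ := by
    filter_upwards [ae_subset_edgeSet (slabGraph 3 k) p] with ω' hω'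
    rintro ⟨h1, h2⟩
    exact ⟨h1, Q₁.evNear_mono (Nat.zero_le ρ) (mem_evNear_mirrorGlue hn hω hA hω' h1 h2)⟩
  have hmono : P.real (Q₁.evAB k ∩ E₂) ≤ P.real (Q₁.evAB k ∩ Q₁.evNear k ρ) := by
    simp only [measureReal_def]
    exact ENNReal.toReal_mono (measure_ne_top _ _) (measure_mono_ae hae)
  calc P.real (Q₁.evAB k) ^ 2 = P.real (Q₁.evAB k) * P.real E₂ := by rw [sq, hsymm]
    _ ≤ _ := hH.trans hmono

/-- **The glued event is a left–right crossing**: `P[Q₁.evCA] = P[τC ⟷^{R'} C] ≤ f(14n, 13n)`.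
[cite: NewmanTassionWu2017, §3.5 (proof of Lemma 3.16, (3.44): Y ↔ Y′ in K_□ gives f(14n,13n))] -/
theorem real_evCA_mirrorGlue_le (Γ : List (slab 3 k)) (p : unitInterval) :
    (bondPercolation (slabGraph 3 k) p).real ((mirrorGlue n hn Γ ρ₂).evCA k) ≤
      (bondPercolation (slabGraph 3 k) p).real
        (slabConn k (boxR 0 (14 * n) 0 (13 * n)) {z | z.1 = 0} {z | z.1 = 14 * n}) := by
  have h1 : (mirrorGlue n hn Γ ρ₂).evCA k ⊆
      slabConn k (boxR 0 (14 * n) 0 (13 * n - 1)) {z | z.1 = 0} {z | z.1 = 14 * n} := by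
    intro ω hω
    have hω' : ω ∈ slabConn k (case2Setup n hn).R (planarReflect (14 * (n : ℤ)) '' (case2Setup n hn).C)
        (case2Setup n hn).C := hω
    refine slabConn_comm (slabConn_mono_sets (k := k) (subset_of_eq (case2Setup_R hn)) ?_ ?_ hω')
    · rintro z ⟨w, hw, rfl⟩
      rw [case2Setup_C, sideSeg, Set.mem_setOf_eq] at hw
      show (planarReflect (14 * (n : ℤ)) w).1 = 14 * n
      rw [planarReflect_apply]; simp only; omega
    · intro z hz
      rw [case2Setup_C, sideSeg, Set.mem_setOf_eq] at hz
      exact hz.1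
  exact (measureReal_mono h1).trans (real_lr_le_taller (le_refl _) (by omega) p)

/-- **NTW 2017, Lemma 3.16 / `(H316)` from local gadgets.** Fix `k ≥ 1`, radii `ρ ≥ 2`, `r`, `ρ₂`,
`0 < p < 1` and `n₀`. Suppose that for every `n ≥ n₀` (`n ≥ 1`), every admissible lattice
configuration `ω` (`A ⟷^{S'} B`, so `Γ = Q.γ ω` exists) and every lattice configuration `ω'` of
`Q₁.evXn ρ` (`Q₁ = mirrorGlue n Γ ρ₂`: `C ⟷^{R'∖𝒩(Γ,ρ₂)} τΓ`, `τC̄` joined inside `R̄'` to within `ρ`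
of the minimal path, not yet `τC ⟷^{R'} C`) a local modification `GadgetSpec Q₁ k r ω' ω''` exists.
Then `(H316)` holds with `y = x²/(1 + λ^s)`, `λ = 2/min{p,1-p}`, `s = 3(5k+4)(4r+1)²`: for
`n ≥ max n₀ 1` and admissible `ω`, `x ≤ P[C ⟷^{R'∖𝒞(ω)} 𝖡]` implies `y ≤ f(14n, 13n)`.
[cite: NewmanTassionWu2017, §3.5 (Lemma 3.16 and proof of Theorem 3.14, Case 3, (3.49)–(3.52))] -/
theorem h316_of_gadgets {ρ r n₀ : ℕ} (p : unitInterval) (hp0 : 0 < (p : ℝ)) (hp1 : (p : ℝ) < 1)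
    (hgad : ∀ (n : ℕ) (hn : 1 ≤ n), n₀ ≤ n → ∀ ω : BondConfig (slab 3 k), ω ⊆ (slabGraph 3 k).edgeSet →
      ω ∈ (case2Setup n hn).Q.evAB k → ∀ ω' : BondConfig (slab 3 k), ω' ⊆ (slabGraph 3 k).edgeSet →
      ω' ∈ (mirrorGlue n hn ((case2Setup n hn).Q.γ k ω) ρ₂).evXn k ρ →
      ∃ ω'', GadgetSpec (mirrorGlue n hn ((case2Setup n hn).Q.γ k ω) ρ₂) k r ω' ω'') :
    ∀ x : ℝ, 0 < x → ∃ y : ℝ, 0 < y ∧ ∃ n₃ : ℕ, ∀ n : ℕ, n₃ ≤ n → ∀ hn : 1 ≤ n,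
      ∀ ω : BondConfig (slab 3 k), ω ⊆ (slabGraph 3 k).edgeSet →
      ω ∈ (case2Setup n hn).Q.evAB k → ω ∈ slabConn k (case2Setup n hn).R {z | z.2 = 0} (case2Setup n hn).C →
      ω ∉ (case2Setup n hn).Q.evCA k → ω ∉ (case2Setup n hn).Q.evNear k ρ₂ →
      x ≤ (bondPercolation (slabGraph 3 k) p).real
        ((case2Setup n hn).Q.evOff k {z | z.2 = 0} ((case2Setup n hn).Q.explored k ρ₂ ω)) →
      y ≤ (bondPercolation (slabGraph 3 k) p).real
        (slabConn k (boxR 0 (14 * n) 0 (13 * n)) {z | z.1 = 0} {z | z.1 = 14 * n}) := by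
  intro x hx
  set Λ : ℝ := 1 + (2 / min (p : ℝ) (1 - p)) ^ (3 * ((5 * k + 4) * (2 * (2 * r) + 1) ^ 2)) with hΛ
  have hΛpos : 0 < Λ := by positivity
  refine ⟨x ^ 2 / Λ, by positivity, max n₀ 1, fun n hn3 hn ω hω hAB _ _ _ hxoff => ?_⟩
  have hn₀ : n₀ ≤ n := le_trans (le_max_left _ _) hn3
  set P := bondPercolation (slabGraph 3 k) p with hP
  set Q₁ := mirrorGlue n hn ((case2Setup n hn).Q.γ k ω) ρ₂ with hQ₁
  -- separation: `x ≤ P[E₁]`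
  have h1 : x ≤ P.real (Q₁.evAB k) :=
    hxoff.trans (real_evOff_explored_le_toMirror hn hω hAB p)
  -- crossing + Harris: `P[E₁]² ≤ P[evAB ∩ evNear ρ]`
  have h2 := real_sq_le_mirrorGlue hn hω hAB p ρ (ρ₂ := ρ₂)
  -- gadgets: `P[evAB ∩ evNear ρ] ≤ Λ P[evCA]`
  have h3 := real_evAB_inter_evNear_le_of_gadgets (Q := Q₁) (ρ := ρ) (r := r) p hp0 hp1
    (hgad n hn hn₀ ω hω hAB)
  -- the glued event is a crossing
  have h4 := real_evCA_mirrorGlue_le hn (ρ₂ := ρ₂) ((case2Setup n hn).Q.γ k ω) p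
  rw [div_le_iff₀ hΛpos]
  calc x ^ 2 ≤ P.real (Q₁.evAB k) ^ 2 := pow_le_pow_left₀ hx.le h1 2
    _ ≤ _ := h2
    _ ≤ _ := h3
    _ ≤ Λ * _ := by rw [← hΛ]; exact mul_le_mul_of_nonneg_left h4 hΛpos.le
    _ = _ := mul_comm _ _

end L316

end NTW17

end Literature.Probability.Percolation
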